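import Summits.Ventures.PercRepro.C041FourExitCount

/-!
# ROW C-041 — counting tools for the four-exit attachment: indicators, the inclusion–exclusion of a block, the sum
of a product of one-coordinate indicators over the quadruple space (p6, gen 31; r = 4 groundwork, step (4))

`boole_and'` (the indicator of a conjunction is the product), `boole_block2` / `boole_block3` / `boole_block4`
(the indicator of «all in the first classes or all in the second» is the inclusion–exclusion with the coordinatewise
intersections), `cls_inter` (`cls (F,T) ∩ cls (T,F) = cls (T,T)`), and `sum_prod4_ind` (the sum over the quadruple
space of a product of one-coordinate indicators is the product of the cardinalities).  With the membership lemmas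
of `C041FourExitMemA–D` these give every fibre count by one uniform script (`C041FourExitCountA–D`).
-/

namespace PercRepro

namespace ZoneZ

namespace TwoExit

open ZoneData Finset

/-- The indicator of a conjunction is the product. -/
theorem boole_and' (P Q : Prop) [Decidable (P ∧ Q)] [Decidable P] [Decidable Q] :
    (if P ∧ Q then (1 : ℝ) else 0) = (if P then (1 : ℝ) else 0) * (if Q then 1 else 0) := by
  by_cases hP : P <;> by_cases hQ : Q <;> simp [hP, hQ]

/-- The indicator of a two-coordinate block. -/
theorem boole_block2 {A B : Type} (x : A) (y : B) (S₁ S₂ : Finset A) (T₁ T₂ : Finset B) [DecidableEq A]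
    [DecidableEq B] [Decidable ((x ∈ S₁ ∧ y ∈ T₁) ∨ (x ∈ S₂ ∧ y ∈ T₂))] :
    (if (x ∈ S₁ ∧ y ∈ T₁) ∨ (x ∈ S₂ ∧ y ∈ T₂) then (1 : ℝ) else 0) =
      (if x ∈ S₁ then (1 : ℝ) else 0) * (if y ∈ T₁ then 1 else 0) +
        (if x ∈ S₂ then (1 : ℝ) else 0) * (if y ∈ T₂ then 1 else 0) -
        (if x ∈ S₁ ∩ S₂ then (1 : ℝ) else 0) * (if y ∈ T₁ ∩ T₂ then 1 else 0) := by
  simp only [Finset.mem_inter]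
  by_cases h1 : x ∈ S₁ <;> by_cases h2 : x ∈ S₂ <;> by_cases h3 : y ∈ T₁ <;> by_cases h4 : y ∈ T₂ <;>
    simp [h1, h2, h3, h4]

/-- The indicator of a three-coordinate block. -/
theorem boole_block3 {A B C : Type} (x : A) (y : B) (z : C) (S₁ S₂ : Finset A) (T₁ T₂ : Finset B)
    (U₁ U₂ : Finset C) [DecidableEq A] [DecidableEq B] [DecidableEq C]
    [Decidable ((x ∈ S₁ ∧ y ∈ T₁ ∧ z ∈ U₁) ∨ (x ∈ S₂ ∧ y ∈ T₂ ∧ z ∈ U₂))] :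
    (if (x ∈ S₁ ∧ y ∈ T₁ ∧ z ∈ U₁) ∨ (x ∈ S₂ ∧ y ∈ T₂ ∧ z ∈ U₂) then (1 : ℝ) else 0) =
      (if x ∈ S₁ then (1 : ℝ) else 0) * (if y ∈ T₁ then 1 else 0) * (if z ∈ U₁ then 1 else 0) +
        (if x ∈ S₂ then (1 : ℝ) else 0) * (if y ∈ T₂ then 1 else 0) * (if z ∈ U₂ then 1 else 0) -
        (if x ∈ S₁ ∩ S₂ then (1 : ℝ) else 0) * (if y ∈ T₁ ∩ T₂ then 1 else 0) *
          (if z ∈ U₁ ∩ U₂ then 1 else 0) := by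
  simp only [Finset.mem_inter]
  by_cases h1 : x ∈ S₁ <;> by_cases h2 : x ∈ S₂ <;> by_cases h3 : y ∈ T₁ <;> by_cases h4 : y ∈ T₂ <;>
    by_cases h5 : z ∈ U₁ <;> by_cases h6 : z ∈ U₂ <;> simp [h1, h2, h3, h4, h5, h6]

/-- The indicator of a four-coordinate block. -/
theorem boole_block4 {A B C D : Type} (x : A) (y : B) (z : C) (w : D) (S₁ S₂ : Finset A) (T₁ T₂ : Finset B)
    (U₁ U₂ : Finset C) (W₁ W₂ : Finset D) [DecidableEq A] [DecidableEq B] [DecidableEq C] [DecidableEq D]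
    [Decidable ((x ∈ S₁ ∧ y ∈ T₁ ∧ z ∈ U₁ ∧ w ∈ W₁) ∨ (x ∈ S₂ ∧ y ∈ T₂ ∧ z ∈ U₂ ∧ w ∈ W₂))] :
    (if (x ∈ S₁ ∧ y ∈ T₁ ∧ z ∈ U₁ ∧ w ∈ W₁) ∨ (x ∈ S₂ ∧ y ∈ T₂ ∧ z ∈ U₂ ∧ w ∈ W₂) then (1 : ℝ) else 0) =
      (if x ∈ S₁ then (1 : ℝ) else 0) * (if y ∈ T₁ then 1 else 0) * (if z ∈ U₁ then 1 else 0) *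
          (if w ∈ W₁ then 1 else 0) +
        (if x ∈ S₂ then (1 : ℝ) else 0) * (if y ∈ T₂ then 1 else 0) * (if z ∈ U₂ then 1 else 0) *
          (if w ∈ W₂ then 1 else 0) -
        (if x ∈ S₁ ∩ S₂ then (1 : ℝ) else 0) * (if y ∈ T₁ ∩ T₂ then 1 else 0) *
          (if z ∈ U₁ ∩ U₂ then 1 else 0) * (if w ∈ W₁ ∩ W₂ then 1 else 0) := by
  simp only [Finset.mem_inter]
  by_cases h1 : x ∈ S₁ <;> by_cases h2 : x ∈ S₂ <;> by_cases h3 : y ∈ T₁ <;> by_cases h4 : y ∈ T₂ <;>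
    by_cases h5 : z ∈ U₁ <;> by_cases h6 : z ∈ U₂ <;> by_cases h7 : w ∈ W₁ <;> by_cases h8 : w ∈ W₂ <;>
    simp [h1, h2, h3, h4, h5, h6, h7, h8]

/-- The classes `(F,T)` and `(T,F)` meet in `(T,T)`. -/
theorem cls_inter {V E T₁ T₂ : Type} (Z : ZoneData V E T₁ T₂) (a : V) [Fintype E] [Fintype T₁] [Fintype T₂]
    (k : Bool) (r : Prop) : cls Z a false true k r ∩ cls Z a true false k r = cls Z a true true k r := by
  ext τ
  rw [Finset.mem_inter, mem_cls, mem_cls, mem_cls]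
  simp only [Bool.false_eq_true, false_implies, true_implies, true_and]
  tauto

/-- A sum over a four-fold product of a product of one-coordinate indicators. -/
theorem sum_prod4_ind {A B C D : Type} [Fintype A] [Fintype B] [Fintype C] [Fintype D] [DecidableEq A]
    [DecidableEq B] [DecidableEq C] [DecidableEq D] (S₁ : Finset A) (S₂ : Finset B) (S₃ : Finset C) (S₄ : Finset D) :
    (∑ p : A × B × C × D, (if p.1 ∈ S₁ then (1 : ℝ) else 0) * (if p.2.1 ∈ S₂ then 1 else 0) *
      (if p.2.2.1 ∈ S₃ then 1 else 0) * (if p.2.2.2 ∈ S₄ then 1 else 0)) =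
      (#S₁ : ℝ) * #S₂ * #S₃ * #S₄ := by
  have e : ∀ p : A × B × C × D, (if p.1 ∈ S₁ then (1 : ℝ) else 0) * (if p.2.1 ∈ S₂ then 1 else 0) *
      (if p.2.2.1 ∈ S₃ then 1 else 0) * (if p.2.2.2 ∈ S₄ then 1 else 0) =
      if p ∈ S₁ ×ˢ (S₂ ×ˢ (S₃ ×ˢ S₄)) then 1 else 0 := by
    intro p
    simp only [Finset.mem_product]
    rw [boole_and', boole_and', boole_and']
    ring
  simp only [e]
  rw [Finset.sum_boole, Finset.filter_univ_mem, Finset.card_product, Finset.card_product, Finset.card_product]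
  push_cast
  ring

end TwoExit

end ZoneZ

end PercRepro
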